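import Summits.CriticalPhenomena.Ising3DConformalLimit.Theses.TauBallRounding

/-!
# CriticalPhenomena / Ising3DConformalLimit — route TauBallRounding, assembly

Settles item `stmt-CriticalPhenomena-4812` (rank 1, assembly of route
`route-CriticalPhenomena-TauBallRounding`):

`MonotoneRounding → RoundEndpoint → RoundnessTransfer → ExistsScaleCovariantLimit →
InversionUpgradeNormalised → IsingEuclidUpgradeR4NonGaussian → Ising3DConformalLimit`.

Pure logic over the summit's structure predicates
(`Literature/Probability/LatticeModels/ConformalCovariance.lean`,
`Literature/Probability/LatticeModels/ScalingLimit3D.lean`): take `ρ, Δ, S` from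
(C) `ExistsScaleCovariantLimit`; (T2) `RoundEndpoint` applied to (T1) `MonotoneRounding` gives a
directional rate with round endpoint, and (B) `RoundnessTransfer` turns it into
`IsRotationInvariant S`, hence `IsEuclideanInvariant S := ⟨transl, rot⟩`; (D)
`InversionUpgradeNormalised` gives `IsInversionCovariant Δ S`; `IsMoebiusCovariant Δ S :=
⟨Euclid, scale, inversion⟩` by definition; (E) `IsingEuclidUpgradeR4NonGaussian` gives
`HasNontrivialU4 S`; conclude `Ising3DConformalLimit`.
No named facts are used; the theorem is unconditional bookkeeping (it is the route's deciding
theorem `closes` in curried form).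
-/

namespace Summit.CriticalPhenomena.Ising3DConformalLimit.Theorems

open Summit.CriticalPhenomena.Ising3DConformalLimit.Theses.TauBallRounding
open Literature.Probability.LatticeModels

/-- Settles `stmt-CriticalPhenomena-4812` (exact signature): the assembly
`MonotoneRounding → RoundEndpoint → RoundnessTransfer → ExistsScaleCovariantLimit →
InversionUpgradeNormalised → IsingEuclidUpgradeR4NonGaussian → Ising3DConformalLimit` of route
TauBallRounding.
Proof: `ρ, Δ, S` from (C); (B) applied to ((T2) (T1)) ⇒ `IsRotationInvariant S`;
Euclidean := ⟨transl, rot⟩; (D) ⇒ inversion covariance; Möbius := ⟨Euclid, scale, inversion⟩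
(definition of `IsMoebiusCovariant`); (E) ⇒ `U₄ ≢ 0`. [folklore] -/
theorem tauBallRounding_assembly_proof :
    Summit.CriticalPhenomena.Ising3DConformalLimit.Theses.TauBallRounding.Assembly := by
  unfold Summit.CriticalPhenomena.Ising3DConformalLimit.Theses.TauBallRounding.Assembly
  intro hT1 hT2 hB hC hD hE
  -- (C): a normalised, non-degenerate, translation-invariant, scale-covariant limit S exists
  obtain ⟨ρ, Δ, S, hρ, hΔ, hlim, hnorm, hnd, htr, hsc⟩ := hC
  -- (T1) ⇒ (T2): round endpoint of the τ-ball; (B) transfers roundness to O(3)-invariance of S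
  have hrot : IsRotationInvariant S := hB (hT2 hT1) ρ Δ S hρ hlim hnorm hnd htr hsc
  have heuc : IsEuclideanInvariant S := ⟨htr, hrot⟩
  -- (D): inversion covariance of the normalised Euclidean-invariant scale-covariant limit
  have hinv : IsInversionCovariant Δ S := hD ρ Δ S hρ hlim hnorm hnd heuc hsc
  -- (E): non-Gaussianity
  have hU4 : HasNontrivialU4 S := hE ρ S hρ hlim hnd
  exact ⟨ρ, Δ, S, hρ, hΔ, hlim, hnd, ⟨heuc, hsc, hinv⟩, hU4⟩

end Summit.CriticalPhenomena.Ising3DConformalLimit.Theorems
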